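import Literature.AlgebraicGeometry.Frobenioids.ArithmeticFrobenioidThm64iiArith
import Literature.AlgebraicGeometry.Frobenioids.ArithmeticRealificationOrderCompatOfDeg
import HarnessLib

/-!
# Frobenioids I, Theorem 6.4 (ii) AT THE DATA: the order-compatibility and the uniformity of THE induced
# `Pic_Φ(A₁) ⥲ Pic_Φ(A₂)`, hypothesis-free (sub-DAG rows T64ii/L01, T64ii/L02, T64ii/L04 at the constructions)

Mochizuki, *The geometry of Frobenioids I: the general theory*, Kyushu J. Math. **62** (2008) 293–400, §6,
Theorem 6.4 (ii), kurims text p. 114, proof p. 115 l. 34 – p. 116 l. 3 ("it follows [cf. assertion (i); Corollary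
4.10; Corollary 4.11, (iii)] that for `i = 1, 2`, if `A_i ∈ Ob(C_i^rlf)` are Frobenius-trivial objects such that
`A₂ = Ψ^rlf(A₁)` then the isomorphism of groups `Pic_Φ(A₁) ⥲ Pic_Φ(A₂)` determined by `Ψ^rlf` [which is
well-defined, by Corollary 4.10; Corollary 4.11, (iii)] is compatible with the 'order structure' induced on both
sides [via `δ_{A₁}`, `δ_{A₂}`] by the 'order structure' of `ℝ`. [Indeed, this compatibility follows from the fact
that the isomorphism in question arises from an isomorphism of monoids `Φ₁^rlf(A₁) ⥲ Φ₂^rlf(A₂)`.]")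
[cite: MochizukiFrdI2008, Thm. 6.4 (ii) p.115].

PROOF-ONLY file (cell abc-iut, layer L1, node `FrdI:Thm6.4(ii)`, sub-DAG `plan/L1/SUBDAG-FrdI-Thm64.md` rows
T64ii/L01 · T64ii/L02 · T64ii/L04 AT THE DATA; seat abc-iut-w4-d086 gen 6; no definitions).  The composition of
seat abc-iut-L6-t10's hypothesis-free assembly `ArithFrd.thm64ii_arith'` (`ArithmeticFrobenioidThm64iiArith.lean`:
for EVERY equivalence `Ψ^rlf : C_{K₁/F₁}^rlf ⥲ C_{K₂/F₂}^rlf`, THE Cor. 4.11 data `(Ψ^Base, η, E = Ψ^Φ)` of `Ψ^rlf`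
and THE induced `picMap` satisfy the typed `Thm64ii` for THE `ArithRealification`s) with this seat's schema-level
consequences of the degree relation (`ArithmeticRealificationOrderCompatOfDeg.lean`:
`Thm64ii_L02_orderCompat_of_thm64iiDeg`, `Thm64ii_L04_uniform_of_thm64iiDeg`).  Results, all for THE picMap of
record (`picMap_A [x] = (η_A)^*[E x]`, i.e. the map "arising from an isomorphism of monoids" — row T64ii/L01):
`ArithFrd.thm64ii_arith_orderCompat'` (the contentful form: the data, the Div formula pinning `E` to `Ψ^rlf`, the
class-map identity, `Thm64ii`, the typed order-compatibility `Thm64ii_L02_orderCompat` — row T64ii/L02 — and the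
uniformity premise of the typed `Thm64ii_of_orderCompat` — row T64ii/L04), and the bare shapes
`ArithFrd.thm64ii_arith_orderCompat` / `ArithFrd.thm64ii_arith_uniform`.  Nothing of the paper is restated or
strengthened; nothing here bears on [IUTchIII] Cor. 3.12.
-/

noncomputable section

namespace Literature.AlgebraicGeometry.Frobenioids

open CategoryTheory Opposite

namespace ArithFrd

variable {F₁ : Type} [Field F₁] [NumberField F₁] {K₁ : Type} [Field K₁] [Algebra F₁ K₁] [IsGalois F₁ K₁]
  {F₂ : Type} [Field F₂] [NumberField F₂] {K₂ : Type} [Field K₂] [Algebra F₂ K₂] [IsGalois F₂ K₂]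
  (hΦ₁ : PreFrobenioid.IsPerfFactorialOn (arithDivisorFunctor F₁ K₁))
  (hΦ₂ : PreFrobenioid.IsPerfFactorialOn (arithDivisorFunctor F₂ K₂))
  (Ψ : PreFrobenioid.rlf (ModelFrobenioid.toElem (arithDivisorFunctor F₁ K₁) (unitsFunctor F₁ K₁) (divNatTrans F₁ K₁)) hΦ₁ ≌
    PreFrobenioid.rlf (ModelFrobenioid.toElem (arithDivisorFunctor F₂ K₂) (unitsFunctor F₂ K₂) (divNatTrans F₂ K₂)) hΦ₂)

/-- **[FrdI] Theorem 6.4 (ii) at THE data — order-compatibility and uniformity of THE induced `picMap`, the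
CONTENTFUL form.**  For every equivalence `Ψ^rlf : C_{K₁/F₁}^rlf ⥲ C_{K₂/F₂}^rlf` there are THE Cor. 4.11 data OF
`Ψ^rlf` — `Ψ^Base` (an equivalence, with the `1`-unique base square `OneUniqueSquare Ψ^rlf Base₁ Base₂ Ψ^Base`),
`η : Base₂ ∘ Ψ^rlf ≅ Ψ^Base ∘ Base₁`, the monoid isomorphism `E = Ψ^Φ : Φ₁^rlf ⥲ Φ₂^rlf` over `Ψ^Base` pinned to
`Ψ^rlf` by `Div(Ψ^rlf φ) = η_A^* E(Div φ)` on ALL arrows — and THE induced `picMap_A : Pic_Φ(A) ⥲ Pic_Φ(Ψ^rlf A)`,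
which (row T64ii/L01) "arises from an isomorphism of monoids": `picMap_A [x] = (η_A)^*[E x]`; and this `picMap`
(1) has a degree (`Thm64ii`), (2) "is compatible with the 'order structure' induced on both sides [via `δ_{A₁}`,
`δ_{A₂}`] by the 'order structure' of `ℝ`" — the typed `Thm64ii_L02_orderCompat` (row T64ii/L02), and (3) the
composites `δ_{Ψ A} ∘ picMap_A ∘ δ_A⁻¹` do not depend on the Frobenius-trivial object `A` — the uniformity
premise of the typed `Thm64ii_of_orderCompat` (row T64ii/L04).  Hypothesis-free: `ArithFrd.thm64ii_arith'` ∘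
`Thm64ii_L02_orderCompat_of_thm64iiDeg` / `Thm64ii_L04_uniform_of_thm64iiDeg`.
[cite: MochizukiFrdI2008, Thm. 6.4 (ii) p.115] -/
theorem thm64ii_arith_orderCompat' :
    ∃ (ΨBase : FinSubextCat F₁ K₁ ⥤ FinSubextCat F₂ K₂) (_ : ΨBase.IsEquivalence)
      (η : Ψ.functor ⋙ (FrdI.Cor54Sub.rlfData (ModelFrobenioid.toElem (arithDivisorFunctor F₂ K₂) (unitsFunctor F₂ K₂)
          (divNatTrans F₂ K₂)) hΦ₂).base ≅
        (FrdI.Cor54Sub.rlfData (ModelFrobenioid.toElem (arithDivisorFunctor F₁ K₁) (unitsFunctor F₁ K₁)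
          (divNatTrans F₁ K₁)) hΦ₁).base ⋙ ΨBase)
      (E : PreFrobenioidData.DivisorMonoidIsoOverBase
        (FrdI.Cor54Sub.rlfData (ModelFrobenioid.toElem (arithDivisorFunctor F₁ K₁) (unitsFunctor F₁ K₁)
          (divNatTrans F₁ K₁)) hΦ₁)
        (FrdI.Cor54Sub.rlfData (ModelFrobenioid.toElem (arithDivisorFunctor F₂ K₂) (unitsFunctor F₂ K₂)
          (divNatTrans F₂ K₂)) hΦ₂) ΨBase)
      (picMap : ∀ A, (arithRealification hΦ₁).Pic A ≃+ (arithRealification hΦ₂).Pic (Ψ.functor.obj A)),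
      PreFrobenioidData.OneUniqueSquare Ψ.functor
          (FrdI.Cor54Sub.rlfData (ModelFrobenioid.toElem (arithDivisorFunctor F₁ K₁) (unitsFunctor F₁ K₁)
            (divNatTrans F₁ K₁)) hΦ₁).base
          (FrdI.Cor54Sub.rlfData (ModelFrobenioid.toElem (arithDivisorFunctor F₂ K₂) (unitsFunctor F₂ K₂)
            (divNatTrans F₂ K₂)) hΦ₂).base ΨBase ∧
      (∀ ⦃A B : PreFrobenioid.rlf (ModelFrobenioid.toElem (arithDivisorFunctor F₁ K₁) (unitsFunctor F₁ K₁)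
          (divNatTrans F₁ K₁)) hΦ₁⦄ (φ : A ⟶ B),
        PreFrobenioid.Div (PreFrobenioid.rlfToElem (ModelFrobenioid.toElem (arithDivisorFunctor F₂ K₂)
            (unitsFunctor F₂ K₂) (divNatTrans F₂ K₂)) hΦ₂) (Ψ.functor.map φ) =
          pull _ (η.hom.app A)
            (E.iso (PreFrobenioid.baseObj (PreFrobenioid.rlfToElem (ModelFrobenioid.toElem
              (arithDivisorFunctor F₁ K₁) (unitsFunctor F₁ K₁) (divNatTrans F₁ K₁)) hΦ₁) A)
              (PreFrobenioid.Div (PreFrobenioid.rlfToElem (ModelFrobenioid.toElem (arithDivisorFunctor F₁ K₁)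
                (unitsFunctor F₁ K₁) (divNatTrans F₁ K₁)) hΦ₁) φ))) ∧
      (∀ (A : PreFrobenioid.rlf (ModelFrobenioid.toElem (arithDivisorFunctor F₁ K₁) (unitsFunctor F₁ K₁)
          (divNatTrans F₁ K₁)) hΦ₁)
        (x : (RealificationData.canonical (arithDivisorFunctor F₁ K₁) (PreFrobenioid.IsPerfFactorialOn.op hΦ₁)).rlf.obj
          (op A.base)),
        picMap A (Additive.ofMul (QuotientGroup.mk' _ (Algebra.GrothendieckGroup.of x))) =
          Additive.ofMul (((RealificationData.canonical (arithDivisorFunctor F₂ K₂)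
            (PreFrobenioid.IsPerfFactorialOn.op hΦ₂)).realSpan (PreFrobenioid.biratSubfunctor
              (ModelFrobenioid.toElem (arithDivisorFunctor F₂ K₂) (unitsFunctor F₂ K₂) (divNatTrans F₂ K₂)))).picPull
            (X := (Ψ.functor.obj A).base) (Y := ΨBase.obj A.base) (η.hom.app A)
            (QuotientGroup.mk' _ (Algebra.GrothendieckGroup.of (E.iso A.base x))))) ∧
      Thm64ii (arithRealification hΦ₁) (arithRealification hΦ₂) Ψ picMap ∧
      Thm64ii_L02_orderCompat (arithRealification hΦ₁) (arithRealification hΦ₂) Ψ picMap ∧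
      (∀ (A B : PreFrobenioid.rlf (ModelFrobenioid.toElem (arithDivisorFunctor F₁ K₁) (unitsFunctor F₁ K₁)
          (divNatTrans F₁ K₁)) hΦ₁)
          (hA : (arithRealification hΦ₁).ops.IsFrobeniusTrivial A)
          (hA' : (arithRealification hΦ₂).ops.IsFrobeniusTrivial (Ψ.functor.obj A))
          (hB : (arithRealification hΦ₁).ops.IsFrobeniusTrivial B)
          (hB' : (arithRealification hΦ₂).ops.IsFrobeniusTrivial (Ψ.functor.obj B)) (t : ℝ),
        (arithRealification hΦ₂).δ _ hA' (picMap A (((arithRealification hΦ₁).δ A hA).symm t)) =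
          (arithRealification hΦ₂).δ _ hB' (picMap B (((arithRealification hΦ₁).δ B hB).symm t))) := by
  obtain ⟨ΨBase, hΨ, η, E, picMap, hsq, hdiv, h, hval, -, -⟩ := thm64ii_arith' hΦ₁ hΦ₂ Ψ
  obtain ⟨deg, hdeg⟩ := h
  exact ⟨ΨBase, hΨ, η, E, picMap, hsq, hdiv, hval, ⟨deg, hdeg⟩,
    Thm64ii_L02_orderCompat_of_thm64iiDeg _ _ Ψ picMap hdeg,
    Thm64ii_L04_uniform_of_thm64iiDeg _ _ Ψ picMap hdeg⟩

/-- **[FrdI] Theorem 6.4 (ii) at THE data, row T64ii/L02 — bare shape**: for every equivalence `Ψ^rlf` there is a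
`picMap` (THE induced one of `thm64ii_arith_orderCompat'`) with a degree AND compatible with the order structures
induced by `δ_{A₁}`, `δ_{A₂}` — `Thm64ii ∧ Thm64ii_L02_orderCompat` for THE `ArithRealification`s.  (As with
`ArithFrd.thm64ii_arith`, the content is carried by the clauses of `thm64ii_arith_orderCompat'` tying `picMap` to
`Ψ^rlf`; this is the schema letters' shape.) [cite: MochizukiFrdI2008, Thm. 6.4 (ii) p.115] -/
theorem thm64ii_arith_orderCompat :
    ∃ picMap : ∀ A, (arithRealification hΦ₁).Pic A ≃+ (arithRealification hΦ₂).Pic (Ψ.functor.obj A),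
      Thm64ii (arithRealification hΦ₁) (arithRealification hΦ₂) Ψ picMap ∧
        Thm64ii_L02_orderCompat (arithRealification hΦ₁) (arithRealification hΦ₂) Ψ picMap := by
  obtain ⟨-, -, -, -, picMap, -, -, -, h, hoc, -⟩ := thm64ii_arith_orderCompat' hΦ₁ hΦ₂ Ψ
  exact ⟨picMap, h, hoc⟩

/-- **[FrdI] Theorem 6.4 (ii) at THE data, rows T64ii/L02 + T64ii/L04 — the two premises of the typed
`Thm64ii_of_orderCompat` hold for THE induced `picMap`**: order-compatibility, and the independence of the
composites `δ_{Ψ A} ∘ picMap_A ∘ δ_A⁻¹` from the Frobenius-trivial object `A` (the uniformity implicit in "there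
exists an element `deg(Ψ^rlf)`", p. 114 (ii)).  [cite: MochizukiFrdI2008, Thm. 6.4 (ii) p.114] -/
theorem thm64ii_arith_uniform :
    ∃ picMap : ∀ A, (arithRealification hΦ₁).Pic A ≃+ (arithRealification hΦ₂).Pic (Ψ.functor.obj A),
      Thm64ii_L02_orderCompat (arithRealification hΦ₁) (arithRealification hΦ₂) Ψ picMap ∧
        (∀ (A B : PreFrobenioid.rlf (ModelFrobenioid.toElem (arithDivisorFunctor F₁ K₁) (unitsFunctor F₁ K₁)
            (divNatTrans F₁ K₁)) hΦ₁)
            (hA : (arithRealification hΦ₁).ops.IsFrobeniusTrivial A)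
            (hA' : (arithRealification hΦ₂).ops.IsFrobeniusTrivial (Ψ.functor.obj A))
            (hB : (arithRealification hΦ₁).ops.IsFrobeniusTrivial B)
            (hB' : (arithRealification hΦ₂).ops.IsFrobeniusTrivial (Ψ.functor.obj B)) (t : ℝ),
          (arithRealification hΦ₂).δ _ hA' (picMap A (((arithRealification hΦ₁).δ A hA).symm t)) =
            (arithRealification hΦ₂).δ _ hB' (picMap B (((arithRealification hΦ₁).δ B hB).symm t))) ∧
        Thm64ii (arithRealification hΦ₁) (arithRealification hΦ₂) Ψ picMap := by
  obtain ⟨-, -, -, -, picMap, -, -, -, h, hoc, hunif⟩ := thm64ii_arith_orderCompat' hΦ₁ hΦ₂ Ψ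
  exact ⟨picMap, hoc, hunif, h⟩

end ArithFrd

end Literature.AlgebraicGeometry.Frobenioids

end
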